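import Summits.QuantumFields.YangMills.Theorems.SwapVirialDeficitBlowUpGnomonicTrFibreSockets
import Summits.QuantumFields.YangMills.Theorems.SwapVirialDeficitSectorLaplaceBTubeFibredScaled
import Summits.QuantumFields.YangMills.Theorems.SwapVirialDeficitBlowUpGnomonicBFibreRescaledSockets
import HarnessLib

/-!
# STUB (S-001-good) OF SKELETON ➎: ★★★ THE FIBRED √b LAW OF SECTOR 001 ON THE WHOLE `(δ, η)`-SPACE — every socket discharged (no cut, no far-floor hypothesis)
# (free-hands support of ⟨stmt-QuantumFields-24197⟩ `SwapVirialDeficit.SwapGluedStiffness`; cell ym-idea-1; twin of w2 g59's ✓`bTube_fibred_scaled_cylinder` ∕ `…_uniform`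
# for the 001 chart ✓`gnoFibreTrEquiv (u, gnoScaleTr u y)` with base set `S = univ`; assembler fcl-p3 g48)

In the letters `(δ, η) ∈ X = ℝ × GnoCoord L` against `μ_B = vol·((1+δ²)⁻¹)²ρ` (✓`trGnoDeficit_eq_hubCot` ∕ ✓`lintegral_chartMeasure_hubCot_muB` translate the two integrals of
`stub_h001_good` into exactly these, up to `coneConst·π`), with `F₁(δ,η) = trGnoDeficit uJ z₁ (sectorChar z₁) (hubAt δ 1) ε η`:
* §1 the rescaled 001 chart `Ψ(u,y) = gnoFibreTrEquiv (u, gnoScaleTr u y)`: `measurable_trScaledChart`, `trScaledChart_injective`, `trScaledChart_surjective`,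
  ★ `volume_muB_restrict_scaledTrTube_eq_map` (tube chart identity over any measurable base set, twin of ✓`volume_muB_restrict_scaledBTube_eq_map`);
* §2 ★★★ `tr_fibred_law (ε) (hz) (hF)` — ∃ operators `A u` (symmetric; RAY identity; `λ₁‖y‖² ≤ ⟪A u y,y⟫` and `λ₁^{m} ≤ det A u` for EVERY `u`, `λ₁ = (5408(1+|Fol L|)L⁶)⁻¹`)
  such that for every radius `0 < R ≤ 1` with `1136016L⁴·R ≤ λ₁∕(8(m+8))`, `2R·R ≤ 1` and every `b > 0`:
  `|∫_X e^{−bF₁} dμ_B − 𝔐(b)| ≤ (K₃∕√b + 16(m+8)∕(λ₁R²b))·𝔐(b) + e^{−b·R²∕(10816(1+|Fol L|)L⁶)}·μ_B(X)`,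
  `𝔐(b) = (2π∕b)^{m∕2}·∫_{ℝ²} (1+u₁²)⁻¹(1+u₂²)⁻¹∕√det(A u) du`, `m = dim V_B = 18L⁴ − 1`, `K₃ = 16A₃(m+8)∕λ₁ + 256A₃(m+8)²∕λ₁² + 2R + 16R(m+8)∕λ₁`, `A₃ = 1136016L⁴`
  (✓`laplaceMethod_quantitative_fibred_chart_cubic_offBound_on` with `S = univ`, sockets ✓`trFibre_rescaled_sockets`, off-tube bound ✓`tr001_hfar_rescaled`).

HONEST LABEL: the 001 √b law; the main-term bounds, the two-sided log law, the stiffness step, the reading on `chartMeasure L` and `stub_h001_good` remain OPEN, as do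
(S-core-tip), (S-end-G), ⟨24197⟩ ∕ ⟨24194⟩; item of record ⟨24085⟩ SubOctaveBounded aside ∕ untouched; the Yang–Mills mass gap is NOT proved; no summit is proved by a line.
THEOREMS ONLY (0 `def`, 0 `sorry`), standard axioms, no instances.  Seat ym-line-fcl-p3 g48 (cell ym-idea-1, free hands), `--supports stmt-QuantumFields-24197`.
References: [cite: Luscher1983, §2]; [cite: HasenpflugRudolfSprungk2024, App. 4.1 Thm 16]; [cite: Breitung1994, §2.3 Definitions 4–5]; [folklore].
-/

set_option autoImplicit false
set_option synthInstance.maxSize 1024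

noncomputable section

open MeasureTheory Quaternion Set Metric Module
open scoped BigOperators Quaternion InnerProductSpace ENNReal
open Literature.MathematicalPhysics.QuantumFieldTheory hiding SU2
open Literature.MathematicalPhysics.QuantumLattice

namespace Summit.QuantumFields.YangMills.Theorems.SwapVirialDeficit.BlowUpRing

open Summit.QuantumFields.YangMills.Theorems.FemtoTransferGap
open Summit.QuantumFields.YangMills.Theorems.FemtoTransferGap.TT
open Summit.QuantumFields.YangMills.Theorems.VirialFluxGap.RingDeficit
open Summit.QuantumFields.YangMills.Theorems.SwapVirialDeficit.SwapRing
open Summit.QuantumFields.YangMills.Theorems.SwapVirialDeficit.Gnomonic (normSq3 normSq3_nonneg gnomonicWeight gnomonicWeight_pos)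
open Summit.QuantumFields.YangMills.Theorems.QuantitativeLaplace (laplaceMethod_quantitative_fibred_chart_cubic_offBound_on prod_volume_eq_map_diagScale
  diagScale_injective measurableSet_image_diagScale restrict_image_eq_map_of_eq_map)
open Summit.QuantumFields.YangMills.Theorems.SwapVirialDeficit.SectorLaplace (z₁ uJ sectorChar)

variable {L : ℕ} [NeZero L]

/-! ## §1 The rescaled 001 chart and its tube chart identity -/

/-- The rescaled 001 chart `Ψ(u, y) = gnoFibreTrEquiv (u, gnoScaleTr u y)` is measurable. [folklore] -/
theorem measurable_trScaledChart : Measurable fun q : (ℝ × ℝ) × GnoFibreB L => gnoFibreTrEquiv (q.1, gnoScaleTr q.1 q.2) := by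
  have h := Measurable.comp (gnoFibreTrEquiv (L := L)).measurable (measurable_fst.prodMk (measurable_gnoScaleTr_prod (L := L)))
  exact h

/-- `Ψ` is injective. [folklore] -/
theorem trScaledChart_injective : Function.Injective fun q : (ℝ × ℝ) × GnoFibreB L => gnoFibreTrEquiv (q.1, gnoScaleTr q.1 q.2) := by
  intro q q' h
  have h1 : (q.1, gnoScaleTr q.1 q.2) = (q'.1, gnoScaleTr q'.1 q'.2) := (gnoFibreTrEquiv (L := L)).injective h
  exact diagScale_injective (c := fun (u : ℝ × ℝ) (i : GnoFibreBIdx L) => gnoFibreTrScale (L := L) u i) (fun u i => (gnoFibreTrScale_pos u i).ne') h1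

/-- `Ψ` is surjective (each rescaling is invertible). [folklore] -/
theorem trScaledChart_surjective : Function.Surjective fun q : (ℝ × ℝ) × GnoFibreB L => gnoFibreTrEquiv (q.1, gnoScaleTr q.1 q.2) := by
  intro p
  obtain ⟨⟨u, y'⟩, rfl⟩ := (gnoFibreTrEquiv (L := L)).surjective p
  refine ⟨(u, (WithLp.toLp 2 fun i => (gnoFibreTrScale u i)⁻¹ * y' i : GnoFibreB L)), ?_⟩
  show gnoFibreTrEquiv (u, gnoScaleTr u (WithLp.toLp 2 fun i => (gnoFibreTrScale u i)⁻¹ * y' i : GnoFibreB L)) = gnoFibreTrEquiv (u, y')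
  congr 2
  exact PiLp.ext fun i => by rw [gnoScaleTr_apply, PiLp.toLp_apply, mul_inv_cancel_left₀ (gnoFibreTrScale_pos u i).ne']

/-- Off the scaled tube of radius `R` over the whole base: `p = Ψ(u, y)` with `R < ‖y‖`. [folklore] -/
theorem exists_of_not_mem_scaledTrTube {R : ℝ} {p : ℝ × GnoCoord L}
    (hpT : p ∉ (fun q : (ℝ × ℝ) × GnoFibreB L => gnoFibreTrEquiv (q.1, gnoScaleTr q.1 q.2)) '' ((univ : Set (ℝ × ℝ)) ×ˢ closedBall (0 : GnoFibreB L) R)) :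
    ∃ u : ℝ × ℝ, ∃ y : GnoFibreB L, R < ‖y‖ ∧ p = gnoFibreTrEquiv (u, gnoScaleTr u y) := by
  obtain ⟨q, rfl⟩ := trScaledChart_surjective (L := L) p
  refine ⟨q.1, q.2, ?_, rfl⟩
  by_contra h
  exact hpT ⟨q, ⟨mem_univ _, mem_closedBall_zero_iff.2 (le_of_not_gt h)⟩, rfl⟩

/-- ★ **THE TUBE CHART IDENTITY OF THE RESCALED 001 CHART** over a measurable base set `S`: the scaled tube `Ψ(S × B̄_R)` is measurable and
`μ_B|_{Ψ(S × B̄_R)} = Ψ_*((((vol ⊗ vol)|_{S × B̄_R})·J)` with `J(u,y) = (Π_i|c_i(u)|)·J_B(Ψ(u,y))` (✓`chart_comp_of_injOn_ofReal` on ✓`volume_withDensity_eq_map_gnoFibreTrEquiv` and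
✓`prod_volume_eq_map_diagScale`). [cite: Breitung1994, §2.3 Definitions 4–5] -/
theorem volume_muB_restrict_scaledTrTube_eq_map {S : Set (ℝ × ℝ)} (hS : MeasurableSet S) (R : ℝ) :
    MeasurableSet ((fun q : (ℝ × ℝ) × GnoFibreB L => gnoFibreTrEquiv (q.1, gnoScaleTr q.1 q.2)) '' (S ×ˢ closedBall (0 : GnoFibreB L) R)) ∧
    ((volume : Measure (ℝ × GnoCoord L)).withDensity (fun p => ENNReal.ofReal (((1 + p.1 ^ 2)⁻¹) ^ 2 * gnoDensity p.2))).restrict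
        ((fun q : (ℝ × ℝ) × GnoFibreB L => gnoFibreTrEquiv (q.1, gnoScaleTr q.1 q.2)) '' (S ×ˢ closedBall (0 : GnoFibreB L) R)) =
      ((((volume : Measure (ℝ × ℝ)).prod (volume : Measure (GnoFibreB L))).restrict (S ×ˢ closedBall (0 : GnoFibreB L) R)).withDensity
        (fun q => ENNReal.ofReal ((∏ i, |gnoFibreTrScale (L := L) q.1 i|) *
          (((1 + (gnoFibreTrEquiv (q.1, gnoScaleTr q.1 q.2)).1 ^ 2)⁻¹) ^ 2 * gnoDensity (gnoFibreTrEquiv (q.1, gnoScaleTr q.1 q.2)).2)))).map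
        (fun q : (ℝ × ℝ) × GnoFibreB L => gnoFibreTrEquiv (q.1, gnoScaleTr q.1 q.2)) := by
  classical
  set Φ : (ℝ × ℝ) × GnoFibreB L → (ℝ × ℝ) × GnoFibreB L :=
    fun q => (q.1, (WithLp.toLp 2 fun i => gnoFibreTrScale q.1 i * q.2 i : GnoFibreB L)) with hΦ
  have hc : ∀ i, Measurable fun u : ℝ × ℝ => gnoFibreTrScale (L := L) u i := measurable_gnoFibreTrScale
  have hc0 : ∀ (u : ℝ × ℝ) (i : GnoFibreBIdx L), gnoFibreTrScale (L := L) u i ≠ 0 := fun u i => (gnoFibreTrScale_pos u i).ne'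
  have hΦm : Measurable Φ := QuantitativeLaplace.measurable_diagScale hc
  have hW : MeasurableSet (S ×ˢ closedBall (0 : GnoFibreB L) R) := hS.prod measurableSet_closedBall
  have hΦW : MeasurableSet (Φ '' (S ×ˢ closedBall (0 : GnoFibreB L) R)) := measurableSet_image_diagScale hc hc0 hW
  have hEΦW : MeasurableSet (gnoFibreTrEquiv '' (Φ '' (S ×ˢ closedBall (0 : GnoFibreB L) R))) :=
    (gnoFibreTrEquiv (L := L)).measurableEmbedding.measurableSet_image.2 hΦW
  have hcomp : (fun q : (ℝ × ℝ) × GnoFibreB L => gnoFibreTrEquiv (q.1, gnoScaleTr q.1 q.2)) = (gnoFibreTrEquiv (L := L)) ∘ Φ := rfl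
  have hΘ : ((volume : Measure (ℝ × GnoCoord L)).withDensity (fun p => ENNReal.ofReal (((1 + p.1 ^ 2)⁻¹) ^ 2 * gnoDensity p.2))).restrict
        (gnoFibreTrEquiv '' (univ : Set ((ℝ × ℝ) × GnoFibreB L))) =
      ((((volume : Measure (ℝ × ℝ)).prod (volume : Measure (GnoFibreB L))).restrict univ).withDensity
        fun v => ENNReal.ofReal (((1 + (gnoFibreTrEquiv v).1 ^ 2)⁻¹) ^ 2 * gnoDensity (gnoFibreTrEquiv v).2)).map (gnoFibreTrEquiv (L := L)) := by
    rw [image_univ_of_surjective (gnoFibreTrEquiv (L := L)).surjective, Measure.restrict_univ, Measure.restrict_univ]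
    exact volume_withDensity_eq_map_gnoFibreTrEquiv (ENNReal.measurable_ofReal.comp measurable_bDensity)
  have hΨ : ((volume : Measure (ℝ × ℝ)).prod (volume : Measure (GnoFibreB L))).restrict (Φ '' (S ×ˢ closedBall (0 : GnoFibreB L) R)) =
      ((((volume : Measure (ℝ × ℝ)).prod (volume : Measure (GnoFibreB L))).restrict (S ×ˢ closedBall (0 : GnoFibreB L) R)).withDensity
        fun q => ENNReal.ofReal (∏ i, |gnoFibreTrScale (L := L) q.1 i|)).map Φ :=
    restrict_image_eq_map_of_eq_map hΦm (diagScale_injective hc0) (prod_volume_eq_map_diagScale (volume : Measure (ℝ × ℝ)) hc hc0) hW hΦW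
  have key := Literature.Analysis.Asymptotics.chart_comp_of_injOn_ofReal
    (μ := (volume : Measure (ℝ × GnoCoord L)).withDensity fun p => ENNReal.ofReal (((1 + p.1 ^ 2)⁻¹) ^ 2 * gnoDensity p.2))
    (κ := (volume : Measure (ℝ × ℝ)).prod (volume : Measure (GnoFibreB L))) (ν := (volume : Measure (ℝ × ℝ)).prod (volume : Measure (GnoFibreB L)))
    (Θ := gnoFibreTrEquiv (L := L)) (Ω := univ) (J₁ := fun v => ((1 + (gnoFibreTrEquiv v).1 ^ 2)⁻¹) ^ 2 * gnoDensity (gnoFibreTrEquiv v).2) (Ψ := Φ)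
    (W := S ×ˢ closedBall (0 : GnoFibreB L) R) (J₂ := fun q => ∏ i, |gnoFibreTrScale (L := L) q.1 i|)
    (gnoFibreTrEquiv (L := L)).measurable hΦm (gnoFibreTrEquiv (L := L)).injective.injOn (measurable_bDensity.comp (gnoFibreTrEquiv (L := L)).measurable)
    (Finset.measurable_prod _ fun i _ => ((hc i).comp measurable_fst).abs) (fun q => Finset.prod_nonneg fun i _ => abs_nonneg _) (subset_univ _) hEΦW hΘ hΨ
  rw [hcomp]
  refine ⟨by rw [image_comp]; exact hEΦW, ?_⟩
  exact key

/-! ## §2 The 001 √b law on the whole space -/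

set_option maxHeartbeats 800000 in
/-- ★★★ **THE FIBRED √b LAW OF SECTOR 001 ON THE WHOLE `(δ, η)`-SPACE** (good sign patterns: slaving letter and followers `+`).  There are operators `A u` on `V_B`
(symmetric; RAY identity `⟪A u y,y⟫ = (d²∕ds²)F₁(Ψ(u, s·y))|₀`; `λ₁‖y‖² ≤ ⟪A u y,y⟫` and `λ₁^{m} ≤ det A u` for EVERY `u ∈ ℝ²`, `λ₁ = (5408(1+|Fol L|)L⁶)⁻¹`) such that for every
`0 < R ≤ 1` with `1136016L⁴·R ≤ λ₁∕(8(m+8))`, `2R·R ≤ 1`, and every `b > 0`: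
`|∫_X e^{−bF₁} dμ_B − (2π∕b)^{m∕2}∫_{ℝ²} w₀∕√det A| ≤ (K₃∕√b + 16(m+8)∕(λ₁R²b))·(2π∕b)^{m∕2}∫_{ℝ²} w₀∕√det A + e^{−b·R²∕(10816(1+|Fol L|)L⁶)}·μ_B(X)`,
`w₀(u) = (1+u₁²)⁻¹(1+u₂²)⁻¹`. [cite: Luscher1983, §2] [cite: HasenpflugRudolfSprungk2024, App. 4.1 Thm 16] -/
theorem tr_fibred_law (ε : GnoSign L) (hz : ε.2.1 = true) (hF : ε.2.2 = fun _ => true) :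
    ∃ A : ℝ × ℝ → GnoFibreB L →ₗ[ℝ] GnoFibreB L,
      (∀ u, (A u).IsSymmetric) ∧
      (∀ u (y : GnoFibreB L), ⟪A u y, y⟫_ℝ =
        iteratedDeriv 2 (fun s : ℝ =>
          trGnoDeficit uJ z₁ (sectorChar z₁) (hubAt (gnoFibreTrEquiv (u, gnoScaleTr u (s • y))).1 1) ε (gnoFibreTrEquiv (u, gnoScaleTr u (s • y))).2) 0) ∧
      (∀ u (y : GnoFibreB L), (5408 * (1 + (Fintype.card (Fol L) : ℝ)) * (L : ℝ) ^ 6)⁻¹ * ‖y‖ ^ 2 ≤ ⟪A u y, y⟫_ℝ) ∧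
      (∀ u, ((5408 * (1 + (Fintype.card (Fol L) : ℝ)) * (L : ℝ) ^ 6)⁻¹) ^ finrank ℝ (GnoFibreB L) ≤ LinearMap.det (A u)) ∧
      ∀ {R b : ℝ}, 0 < R → R ≤ 1 → 0 < b →
        1136016 * (L : ℝ) ^ 4 * R ≤ (5408 * (1 + (Fintype.card (Fol L) : ℝ)) * (L : ℝ) ^ 6)⁻¹ / (8 * ((finrank ℝ (GnoFibreB L) : ℝ) + 8)) → 2 * R * R ≤ 1 →
        |(∫ p, Real.exp (-(b * trGnoDeficit uJ z₁ (sectorChar z₁) (hubAt p.1 1) ε p.2))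
              ∂((volume : Measure (ℝ × GnoCoord L)).withDensity fun p => ENNReal.ofReal (((1 + p.1 ^ 2)⁻¹) ^ 2 * gnoDensity p.2))) -
            (2 * Real.pi / b) ^ ((finrank ℝ (GnoFibreB L) : ℝ) / 2) *
              ∫ u in (univ : Set (ℝ × ℝ)), (1 + u.1 ^ 2)⁻¹ * (1 + u.2 ^ 2)⁻¹ / Real.sqrt (LinearMap.det (A u))| ≤
          ((16 * (1136016 * (L : ℝ) ^ 4) * ((finrank ℝ (GnoFibreB L) : ℝ) + 8) / (5408 * (1 + (Fintype.card (Fol L) : ℝ)) * (L : ℝ) ^ 6)⁻¹ +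
                  256 * (1136016 * (L : ℝ) ^ 4) * ((finrank ℝ (GnoFibreB L) : ℝ) + 8) ^ 2 / ((5408 * (1 + (Fintype.card (Fol L) : ℝ)) * (L : ℝ) ^ 6)⁻¹) ^ 2 + 2 * R +
                  8 * (2 * R) * ((finrank ℝ (GnoFibreB L) : ℝ) + 8) / (5408 * (1 + (Fintype.card (Fol L) : ℝ)) * (L : ℝ) ^ 6)⁻¹) / Real.sqrt b +
              16 * ((finrank ℝ (GnoFibreB L) : ℝ) + 8) / ((5408 * (1 + (Fintype.card (Fol L) : ℝ)) * (L : ℝ) ^ 6)⁻¹ * R ^ 2) / b) *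
            ((2 * Real.pi / b) ^ ((finrank ℝ (GnoFibreB L) : ℝ) / 2) *
              ∫ u in (univ : Set (ℝ × ℝ)), (1 + u.1 ^ 2)⁻¹ * (1 + u.2 ^ 2)⁻¹ / Real.sqrt (LinearMap.det (A u))) +
          Real.exp (-(b * (R ^ 2 / (10816 * (1 + (Fintype.card (Fol L) : ℝ)) * (L : ℝ) ^ 6)))) *
            ((volume : Measure (ℝ × GnoCoord L)).withDensity fun p => ENNReal.ofReal (((1 + p.1 ^ 2)⁻¹) ^ 2 * gnoDensity p.2)).real univ := by
  obtain ⟨A, ρ, e, hAs, hAm, hρm, hem, hray, hcoer, hf, hρb, hw, heb⟩ := trFibre_rescaled_sockets (L := L) ε hz hF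
  have hL : (0 : ℝ) < (L : ℝ) := by exact_mod_cast NeZero.pos L
  set lam : ℝ := (5408 * (1 + (Fintype.card (Fol L) : ℝ)) * (L : ℝ) ^ 6)⁻¹ with hlam
  have hlam0 : 0 < lam := by positivity
  have hdet : ∀ u : ℝ × ℝ, lam ^ finrank ℝ (GnoFibreB L) ≤ LinearMap.det (A u) := fun u => det_ge_pow_of_coercive (hAs u) hlam0 (hcoer u)
  refine ⟨A, hAs, hray, hcoer, hdet, ?_⟩
  intro R b hR hR1 hb hsmall hDR
  -- the measure space and the letters
  set μB : Measure (ℝ × GnoCoord L) := (volume : Measure (ℝ × GnoCoord L)).withDensity fun p => ENNReal.ofReal (((1 + p.1 ^ 2)⁻¹) ^ 2 * gnoDensity p.2) with hμB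
  haveI : IsFiniteMeasure μB := isFiniteMeasure_muB
  set f : ℝ × GnoCoord L → ℝ := fun p => trGnoDeficit uJ z₁ (sectorChar z₁) (hubAt p.1 1) ε p.2 with hfdef
  have hfm : Measurable f := (contDiff_trDeficit (n := 0) ε).continuous.measurable
  set Ψ' : (ℝ × ℝ) × GnoFibreB L → ℝ × GnoCoord L := fun q => gnoFibreTrEquiv (q.1, gnoScaleTr q.1 q.2) with hΨ'
  obtain ⟨hTm, hchart⟩ := volume_muB_restrict_scaledTrTube_eq_map (L := L) MeasurableSet.univ R
  have hΨm : Measurable Ψ' := measurable_trScaledChart (L := L)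
  have hJm : Measurable fun q : (ℝ × ℝ) × GnoFibreB L =>
      (∏ i, |gnoFibreTrScale (L := L) q.1 i|) * (((1 + (gnoFibreTrEquiv (q.1, gnoScaleTr q.1 q.2)).1 ^ 2)⁻¹) ^ 2 * gnoDensity (gnoFibreTrEquiv (q.1, gnoScaleTr q.1 q.2)).2) :=
    (Finset.measurable_prod _ fun i _ => ((measurable_gnoFibreTrScale i).comp measurable_fst).abs).mul (measurable_bDensity.comp (measurable_trScaledChart (L := L)))
  have hJ0 : ∀ q ∈ (univ : Set (ℝ × ℝ)) ×ˢ closedBall (0 : GnoFibreB L) R,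
      0 ≤ (∏ i, |gnoFibreTrScale (L := L) q.1 i|) * (((1 + (gnoFibreTrEquiv (q.1, gnoScaleTr q.1 q.2)).1 ^ 2)⁻¹) ^ 2 * gnoDensity (gnoFibreTrEquiv (q.1, gnoScaleTr q.1 q.2)).2) :=
    fun q _ => mul_nonneg (Finset.prod_nonneg fun i _ => abs_nonneg _) (bDensity_pos _).le
  obtain ⟨-, hw0pos, hw0m, hw0i⟩ := trBaseWeight_facts
  -- the off-tube bound from the far floor
  have hoff : ∀ x, x ∉ Ψ' '' ((univ : Set (ℝ × ℝ)) ×ˢ closedBall (0 : GnoFibreB L) R) →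
      ‖Real.exp (-(b * (f x - 0))) * (1 : ℝ)‖ ≤ Real.exp (-(b * (R ^ 2 / (10816 * (1 + (Fintype.card (Fol L) : ℝ)) * (L : ℝ) ^ 6)))) := by
    intro x hxT
    obtain ⟨u, y, hRy, rfl⟩ := exists_of_not_mem_scaledTrTube (L := L) hxT
    have hfar := tr001_hfar_rescaled (L := L) ε u y hR.le hR1 hRy.le
    rw [mul_one, sub_zero, Real.norm_eq_abs, abs_of_pos (Real.exp_pos _), Real.exp_le_exp, neg_le_neg_iff]
    exact mul_le_mul_of_nonneg_left hfar hb.le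
  -- apply the generic law with `S = univ`, `φ = 1`
  obtain ⟨-, hbd⟩ := laplaceMethod_quantitative_fibred_chart_cubic_offBound_on (X := ℝ × GnoCoord L) (μ := μB) (M := ℝ × ℝ) (ν := volume) (V := GnoFibreB L)
    (Ψ := Ψ') (J := fun q => (∏ i, |gnoFibreTrScale (L := L) q.1 i|) *
      (((1 + (gnoFibreTrEquiv (q.1, gnoScaleTr q.1 q.2)).1 ^ 2)⁻¹) ^ 2 * gnoDensity (gnoFibreTrEquiv (q.1, gnoScaleTr q.1 q.2)).2)) (f := f) (φ := fun _ => (1 : ℝ)) (f₀ := 0)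
    MeasurableSet.univ (mem_univ ((0 : ℝ), (0 : ℝ))) (A := A) (fun u _ => hAs u) hlam0 (fun u _ y => hcoer u y) hAm (R := R) (A₃ := 1136016 * (L : ℝ) ^ 4)
    (D := 2 * R) (β := b) (Eoff := Real.exp (-(b * (R ^ 2 / (10816 * (1 + (Fintype.card (Fol L) : ℝ)) * (L : ℝ) ^ 6)))))
    hR (by positivity) (by positivity) hb hsmall hDR hΨm hTm hJm hJ0 hchart hfm measurable_const hρm hem hw0m (fun u _ => (hw0pos u).le) hw0i.integrableOn
    (fun u _ y _ => hρb u y) (fun u _ y hy => heb R hR.le u y hy) (fun u _ y _ => hf u y) (fun u _ y _ => hw u y) (by positivity) (Filter.Eventually.of_forall hoff)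
  have hlhs : ∫ x, Real.exp (-(b * (f x - 0))) * (1 : ℝ) ∂μB = ∫ p, Real.exp (-(b * f p)) ∂μB := by
    refine integral_congr_ae (Filter.Eventually.of_forall fun x => ?_)
    show Real.exp (-(b * (f x - 0))) * 1 = Real.exp (-(b * f x))
    rw [sub_zero, mul_one]
  rw [hlhs] at hbd
  exact hbd

end Summit.QuantumFields.YangMills.Theorems.SwapVirialDeficit.BlowUpRing

end
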